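import Summits.Schanuel.Schanuel.Theorems.RootDecomp1KHyper57

/-!
# RootDecomp1KHyper — lens 6, generation 17 «BILOG STAIRCASE CELL» (BilogStair.lean edition 2 f0528a77…, 2567 l) — continuation (RootDecomp1KHyper58): §E.2 `linearIndependent_zB` (elementary) and the member's placement

(lens-6 g17 `BilogStair.lean` edition 2, sha256 f0528a77…5850, own farm rc 0 · 0 sorry · axioms std; critic ACK STATUS L1737 PORT GO LOW (registered, no credit);
port by census-1 gen 15 in ten parts `RootDecomp1KHyper53`–`62` — see the PORT NOTE of part 53; `--supports stmt-Schanuel-33363`; rung 0.)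
-/

open Complex Polynomial IntermediateField Filter
open scoped BigOperators

namespace Summit.Schanuel.Schanuel.Theorems.RootDecomp1KHyper

namespace HyperCell

namespace LatCell

namespace Bilog

/-- **`z_B` is linearly independent over `ℚ`** (hypothesis-free). -/
theorem linearIndependent_zB : LinearIndependent ℚ zB := by
  rw [Fintype.linearIndependent_iff]
  intro g hg
  have hsum : ∑ i, g i • zB i =
      (((g 0 : ℝ) * Real.pi + (g 1 : ℝ) * ell + (g 2 : ℝ) * yB : ℝ) : ℂ) * I := by
    simp only [Fin.sum_univ_three, zB, Matrix.cons_val_zero, Matrix.cons_val_one, Matrix.cons_val_two,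
      Matrix.head_cons, Matrix.tail_cons, Rat.smul_def]
    push_cast; ring
  have hrel : (g 0 : ℝ) * Real.pi + (g 1 : ℝ) * ell + (g 2 : ℝ) * yB = 0 := by
    have h0 := hg
    rw [hsum] at h0
    rcases mul_eq_zero.mp h0 with h | h
    · exact_mod_cast h
    · exact absurd h I_ne_zero
  by_cases hg2 : g 2 = 0
  · -- a relation between `π` and `ℓ₀` only
    have hg1 : g 1 = 0 := by
      by_contra hg1
      have hV : (g 1).num * ((g 0).den : ℤ) ≠ 0 :=
        mul_ne_zero (Rat.num_ne_zero.mpr hg1) (by exact_mod_cast (g 0).den_nz)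
      have key := lattice_ne_zero ((g 0).num * ((g 1).den : ℤ)) hV
      apply key
      have e0 : ((g 0).num : ℝ) = (g 0 : ℝ) * (g 0).den := by exact_mod_cast (Rat.mul_den_eq_num (g 0)).symm
      have e1 : ((g 1).num : ℝ) = (g 1 : ℝ) * (g 1).den := by exact_mod_cast (Rat.mul_den_eq_num (g 1)).symm
      have h01 : (g 0 : ℝ) * Real.pi + (g 1 : ℝ) * ell = 0 := by
        have := hrel; rw [hg2] at this; push_cast at this; linarith
      push_cast
      rw [e0, e1]
      linear_combination ((g 0).den * (g 1).den : ℝ) * h01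
    have hg0 : g 0 = 0 := by
      have := hrel
      rw [hg1, hg2] at this
      push_cast at this
      have hπ := Real.pi_pos
      have : (g 0 : ℝ) = 0 := by nlinarith
      exact_mod_cast this
    intro i
    fin_cases i
    · exact hg0
    · exact hg1
    · exact hg2
  · exfalso
    -- `y_B = sπ + tℓ₀` with `s, t ∈ ℚ`
    obtain ⟨s, hs⟩ : ∃ s : ℚ, s = -g 0 / g 2 := ⟨_, rfl⟩
    obtain ⟨t, ht⟩ : ∃ t : ℚ, t = -g 1 / g 2 := ⟨_, rfl⟩
    have hg2' : (g 2 : ℝ) ≠ 0 := by exact_mod_cast hg2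
    have hy : yB = (s : ℝ) * Real.pi + (t : ℝ) * ell := by
      rw [hs, ht]; push_cast
      field_simp
      linear_combination hrel
    -- common denominator and integer numerators
    obtain ⟨d, hd⟩ : ∃ d : ℕ, d = s.den * t.den := ⟨_, rfl⟩
    have hdpos : 0 < d := by rw [hd]; exact Nat.mul_pos s.den_pos t.den_pos
    obtain ⟨S, hSdef⟩ : ∃ S : ℤ, S = s.num * (t.den : ℤ) := ⟨_, rfl⟩
    obtain ⟨T, hTdef⟩ : ∃ T : ℤ, T = t.num * (s.den : ℤ) := ⟨_, rfl⟩
    have hS : (S : ℝ) = (s : ℝ) * d := by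
      have e := (Rat.mul_den_eq_num s).symm
      have e' : ((s.num : ℚ) : ℝ) = ((s * s.den : ℚ) : ℝ) := by rw [← e]
      rw [hSdef, hd]; push_cast at e' ⊢; rw [e']; ring
    have hT : (T : ℝ) = (t : ℝ) * d := by
      have e := (Rat.mul_den_eq_num t).symm
      have e' : ((t.num : ℚ) : ℝ) = ((t * t.den : ℚ) : ℝ) := by rw [← e]
      rw [hTdef, hd]; push_cast at e' ⊢; rw [e']; ring
    -- the level `K`
    obtain ⟨c₀, hc₀⟩ : ∃ c₀ : ℕ, c₀ = T.natAbs + d := ⟨_, rfl⟩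
    obtain ⟨m, hm⟩ : ∃ m : ℕ, m = c₀ + d + 2 := ⟨_, rfl⟩
    obtain ⟨K, hK⟩ : ∃ K : ℕ, K = 3 * m + 3 := ⟨_, rfl⟩
    obtain ⟨U, hU⟩ : ∃ U : ℤ, U = 2 ^ hexp K * S - (d : ℤ) * (pmP K : ℤ) := ⟨_, rfl⟩
    obtain ⟨V, hVdef⟩ : ∃ V : ℤ, V = 2 ^ hexp K * T - (d : ℤ) * (pmM K : ℤ) := ⟨_, rfl⟩
    have herr : ((d * 2 ^ hexp K : ℕ) : ℝ) * (yB - ((aB K : ℝ) * Real.pi + (bB K : ℝ) * ell)) =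
        (U : ℝ) * Real.pi + (V : ℝ) * ell := by
      rw [hy, hU, hVdef]
      unfold aB bB
      push_cast
      rw [hS, hT]
      field_simp
      ring
    have hEpos : (0 : ℝ) < ((d * 2 ^ hexp K : ℕ) : ℝ) := by positivity
    have hprod_pos : 0 < ((d * 2 ^ hexp K : ℕ) : ℝ) * (yB - ((aB K : ℝ) * Real.pi + (bB K : ℝ) * ell)) :=
      mul_pos hEpos (err_pos K)
    -- `|V| ≤ 2^{a_K} c₀`
    have hVle : V.natAbs ≤ 2 ^ hexp K * c₀ := by
      have hM : (pmM K : ℤ) ≤ 2 ^ hexp K := by exact_mod_cast pmM_le_pow K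
      have hM0 : (0 : ℤ) ≤ pmM K := by positivity
      have h2 : (0 : ℤ) ≤ 2 ^ hexp K := by positivity
      have hd0 : (0 : ℤ) ≤ d := by positivity
      have p1 : 2 ^ hexp K * T ≤ 2 ^ hexp K * |T| := mul_le_mul_of_nonneg_left (le_abs_self T) h2
      have p2 : -(2 ^ hexp K * |T|) ≤ 2 ^ hexp K * T := by
        have := mul_le_mul_of_nonneg_left (neg_abs_le T) h2; linarith
      have p3 : (d : ℤ) * (pmM K : ℤ) ≤ d * 2 ^ hexp K := mul_le_mul_of_nonneg_left hM hd0
      have p4 : (0 : ℤ) ≤ (d : ℤ) * (pmM K : ℤ) := mul_nonneg hd0 hM0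
      have : (V.natAbs : ℤ) ≤ 2 ^ hexp K * c₀ := by
        rw [Int.natCast_natAbs, hVdef, hc₀]
        push_cast
        rw [abs_le]
        constructor <;> nlinarith
      exact_mod_cast this
    -- lower bound `1/5^{2^{a_K} c₀} ≤ E·err_K`
    have hlow : 1 / (5 : ℝ) ^ (2 ^ hexp K * c₀) ≤
        ((d * 2 ^ hexp K : ℕ) : ℝ) * (yB - ((aB K : ℝ) * Real.pi + (bB K : ℝ) * ell)) := by
      by_cases hV : V = 0
      · -- then `E·err_K = Uπ` with `U ≥ 1`
        rw [hV] at herr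
        have hUpos : (0 : ℝ) < (U : ℝ) := by
          have := hprod_pos; rw [herr] at this; push_cast at this
          nlinarith [Real.pi_pos]
        have hU1 : (1 : ℝ) ≤ (U : ℝ) := by exact_mod_cast (show (1 : ℤ) ≤ U by exact_mod_cast hUpos)
        calc 1 / (5 : ℝ) ^ (2 ^ hexp K * c₀) ≤ 1 := by
              rw [div_le_one (by positivity)]; exact one_le_pow₀ (by norm_num)
          _ ≤ (U : ℝ) * Real.pi := by nlinarith [Real.pi_gt_three]
          _ = _ := by rw [herr]; push_cast; ring
      · calc 1 / (5 : ℝ) ^ (2 ^ hexp K * c₀) ≤ 1 / (5 : ℝ) ^ V.natAbs :=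
              one_div_le_one_div_of_le (by positivity) (pow_le_pow_right₀ (by norm_num) hVle)
          _ ≤ |(U : ℝ) * Real.pi + (V : ℝ) * ell| := lattice_lower U hV
          _ = _ := by rw [← herr, abs_of_pos hprod_pos]
    -- upper bound and the arithmetic
    have hup : ((d * 2 ^ hexp K : ℕ) : ℝ) * (yB - ((aB K : ℝ) * Real.pi + (bB K : ℝ) * ell)) ≤
        ((d * 2 ^ hexp K : ℕ) : ℝ) * (10 * (1 / (2 : ℝ) ^ hexp (K + 1))) :=
      mul_le_mul_of_nonneg_left (err_le K) hEpos.le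
    have hnat := arith_K c₀ d m K hm hK
    have hR : (10 : ℝ) * ((d * 2 ^ hexp K : ℕ) : ℝ) * (5 : ℝ) ^ (2 ^ hexp K * c₀) <
        (2 : ℝ) ^ hexp (K + 1) := by exact_mod_cast hnat
    have h5 : (0 : ℝ) < (5 : ℝ) ^ (2 ^ hexp K * c₀) := by positivity
    have h2X : (0 : ℝ) < (2 : ℝ) ^ hexp (K + 1) := by positivity
    have hc := hlow.trans hup
    rw [div_le_iff₀ h5] at hc
    have hc' : (2 : ℝ) ^ hexp (K + 1) ≤ 10 * ((d * 2 ^ hexp K : ℕ) : ℝ) * (5 : ℝ) ^ (2 ^ hexp K * c₀) := by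
      have e : ((d * 2 ^ hexp K : ℕ) : ℝ) * (10 * (1 / (2 : ℝ) ^ hexp (K + 1))) * (5 : ℝ) ^ (2 ^ hexp K * c₀)
          = (10 * ((d * 2 ^ hexp K : ℕ) : ℝ) * (5 : ℝ) ^ (2 ^ hexp K * c₀)) / (2 : ℝ) ^ hexp (K + 1) := by
        field_simp
      rw [e, le_div_iff₀ h2X, one_mul] at hc
      exact hc
    linarith

/-- **Full hypothesis-free placement of `z_B`**: LI, hyper-lin-Liouville, and outside the `π`-, exponential- and
algebraic-lattice-anchored cells. -/
theorem placement_zB' :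
    LinearIndependent ℚ zB ∧ HyperLinLiouville zB ∧ ¬ HasPiIntAnchor zB ∧ ¬ HasPiLatAnchor zB ∧
      ¬ HasExpLatAnchor zB ∧ ¬ HasAlgLatAnchor zB :=
  ⟨linearIndependent_zB, placement_zB⟩

end Bilog
end LatCell
end HyperCell
end Summit.Schanuel.Schanuel.Theorems.RootDecomp1KHyper
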